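import Mathlib
import Summits.Ventures.PercRepro2.ZeroEdge
import Summits.Ventures.PercRepro2.ZeroEdges
import Summits.Ventures.PercRepro2.ParallelMerge
import Summits.Ventures.PercRepro2.StarHMulti
import Summits.Ventures.PercRepro2.HMFLeafInvisible
import Summits.Ventures.PercRepro2.StarHLeafClass

/-!
# THE TWO-LEVEL THEOREM: (HMF), hence (HCOV), whenever `a₃` is a pendant at an unmarked `u` all of
whose other edges join `u` to a mark (blind cell PercRepro2, night-1 g14; NIGHT1-G14.md §8)

Two steps on top of the hub-leaf class theorem `StarH.HMF_star_leaf_h` (`a₃` pendant at `u`, `u`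
adjacent exactly to `a₃, a₁, a₂, o, b` by five distinct edges), the pattern of `StarHMulti`:
* `HMF_star_leaf_h_multi`: the hub-leaf with ANY multiplicities at `u` — every edge at `u` joins `u`
  to `a₃` or to one of the four marks, one representative edge of each mark kind named: the extra
  parallel edges at `u` are merged into their representatives (`merge_all_rep`), the merged-away
  weight-`0` edges deleted (`ZeroEdges.HMF_ext_iff`), and the hub-leaf theorem applied on the kept
  edges (the leaf edge `f` has no parallel copy: a second edge at `a₃` contradicts `hleaf`).
* `HMF_leaf_marks`: NO representatives needed — adjoin the four representative edges at `u` with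
  weight `0` (`ZeroEdge`, four times), apply `HMF_star_leaf_h_multi`, transport back.  So: **(HMF)
  and (HCOV) hold whenever `a₃` is a pendant at an unmarked vertex `u` every other edge of which
  joins `u` to `{a₁, a₂, o, b}`** — any multiplicities, any subset of the marks, every weight
  vector, `G − {u, a₃}` arbitrary, no hypothesis on coincidences among `a₁, a₂, o, b`.  This is the
  whole two-level table of the S3 (C4) pendant map (the classes `{o,b}`-leaf, `{a₁,o,b}`-leaf,
  `{a₂,o,b}`-leaf, hub-leaf of S3.10 (G1) with `N(u) ⊆ marks`) in one statement.
* `HMF_leaf_marks_whiskers`: the same when `u` also carries unmarked WHISKERS (pendant edges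
  `{u, y}` to unmarked leaves `y`, stated inline): an unmarked leaf is invisible to the mean field (`HMFLeafInvisible.HMFc_update_leaf`),
  so the whisker weights are set to `0` one by one (`zero_whiskers`) and the whiskers deleted.
-/

open scoped Classical

namespace Summit.Ventures.PercRepro2

namespace StarH

section LeafMulti

variable {V : Type*} {E : Type*} [Fintype E] [DecidableEq E] [Fintype V] [DecidableEq V]
  {R : Type*} [Field R] [LinearOrder R] [IsStrictOrderedRing R]

variable (p : E → R) (ends : E → Sym2 V) {f f₁ f₂ f₃ f₄ : E} {a₃ u a₁ a₂ o b : V}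

/-- **The hub-leaf with any number of parallel edges at `u`**: (HMF) whenever `a₃` is a pendant at
`u` (edge `f`) and every edge at `u` joins `u` to `a₃`, `a₁`, `a₂`, `o` or `b` (one representative
edge of each mark kind named, the four distinct). -/
theorem HMF_star_leaf_h_multi (hp : IsProbVec p) (hf : ends f = s(a₃, u))
    (hf₁ : ends f₁ = s(u, a₁)) (hf₂ : ends f₂ = s(u, a₂)) (hf₃ : ends f₃ = s(u, o))
    (hf₄ : ends f₄ = s(u, b)) (hleaf : ∀ e, a₃ ∈ ends e → e = f)
    (hstar : ∀ e, u ∈ ends e → ends e = s(u, a₃) ∨ ends e = s(u, a₁) ∨ ends e = s(u, a₂) ∨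
      ends e = s(u, o) ∨ ends e = s(u, b))
    (h3u : a₃ ≠ u) (h3o : a₃ ≠ o) (h31 : a₃ ≠ a₁) (h32 : a₃ ≠ a₂) (h3b : a₃ ≠ b) (hu1 : u ≠ a₁)
    (hu2 : u ≠ a₂) (huo : u ≠ o) (hub : u ≠ b) (h12 : f₁ ≠ f₂) (h13 : f₁ ≠ f₃) (h14 : f₁ ≠ f₄)
    (h23 : f₂ ≠ f₃) (h24 : f₂ ≠ f₄) (h34 : f₃ ≠ f₄) : HMF p ends o a₁ a₂ a₃ b := by
  -- the extra edges at `u` (other than the leaf edge and the four coins) and their representatives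
  set S : Finset E :=
    Finset.univ.filter (fun e => u ∈ ends e ∧ e ≠ f ∧ e ≠ f₁ ∧ e ≠ f₂ ∧ e ≠ f₃ ∧ e ≠ f₄) with hSdef
  have hmemS : ∀ e, e ∈ S ↔ u ∈ ends e ∧ e ≠ f ∧ e ≠ f₁ ∧ e ≠ f₂ ∧ e ≠ f₃ ∧ e ≠ f₄ := by
    intro e; rw [hSdef]; simp
  set rep : E → E := fun e => if ends e = s(u, a₁) then f₁ else if ends e = s(u, a₂) then f₂
    else if ends e = s(u, o) then f₃ else if ends e = s(u, b) then f₄ else e with hrep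
  have hfS : f ∉ S := fun h => ((hmemS f).1 h).2.1 rfl
  have hf₁S : f₁ ∉ S := fun h => ((hmemS f₁).1 h).2.2.1 rfl
  have hf₂S : f₂ ∉ S := fun h => ((hmemS f₂).1 h).2.2.2.1 rfl
  have hf₃S : f₃ ∉ S := fun h => ((hmemS f₃).1 h).2.2.2.2.1 rfl
  have hf₄S : f₄ ∉ S := fun h => ((hmemS f₄).1 h).2.2.2.2.2 rfl
  have hS : ∀ e ∈ S, rep e ∉ S ∧ rep e ≠ e ∧ ends (rep e) = ends e := by
    intro e he
    obtain ⟨hmem, hnef, hne₁, hne₂, hne₃, hne₄⟩ := (hmemS e).1 he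
    by_cases h1 : ends e = s(u, a₁)
    · have : rep e = f₁ := by rw [hrep]; simp only [if_pos h1]
      rw [this]; exact ⟨hf₁S, Ne.symm hne₁, hf₁.trans h1.symm⟩
    by_cases h2 : ends e = s(u, a₂)
    · have : rep e = f₂ := by rw [hrep]; simp only [if_neg h1, if_pos h2]
      rw [this]; exact ⟨hf₂S, Ne.symm hne₂, hf₂.trans h2.symm⟩
    by_cases h3 : ends e = s(u, o)
    · have : rep e = f₃ := by rw [hrep]; simp only [if_neg h1, if_neg h2, if_pos h3]
      rw [this]; exact ⟨hf₃S, Ne.symm hne₃, hf₃.trans h3.symm⟩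
    have h4 : ends e = s(u, b) := by
      rcases hstar e hmem with h | h | h | h | h
      · -- a second edge at `a₃`: impossible, `a₃` is a leaf
        exact absurd (hleaf e (by rw [h]; exact Sym2.mem_mk_right u a₃)) hnef
      · exact absurd h h1
      · exact absurd h h2
      · exact absurd h h3
      · exact h
    have : rep e = f₄ := by rw [hrep]; simp only [if_neg h1, if_neg h2, if_neg h3, if_pos h4]
    rw [this]; exact ⟨hf₄S, Ne.symm hne₄, hf₄.trans h4.symm⟩
  obtain ⟨p', hp', hz, -, hiff⟩ := merge_all_rep ends o a₁ a₂ a₃ b S rep hS p hp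
  rw [hiff]
  have h0 : ∀ e, ¬ (e ∉ S) → p' e = 0 := fun e h => hz e (not_not.1 h)
  rw [ZeroEdges.HMF_ext_iff p' ends h0]
  refine HMF_star_leaf_h (ZeroEdges.pR (fun e => e ∉ S) p') (ZeroEdges.endsR (fun e => e ∉ S) ends)
    (ZeroEdges.isProbVec_pR hp') (f := ⟨f, hfS⟩) (f₁ := ⟨f₁, hf₁S⟩) (f₂ := ⟨f₂, hf₂S⟩)
    (f₃ := ⟨f₃, hf₃S⟩) (f₄ := ⟨f₄, hf₄S⟩) hf hf₁ hf₂ hf₃ hf₄ ?_ ?_ h3u h3o h31 h32 h3b hu1 hu2 huo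
    hub (fun h => h12 (congrArg Subtype.val h)) (fun h => h13 (congrArg Subtype.val h))
    (fun h => h14 (congrArg Subtype.val h)) (fun h => h23 (congrArg Subtype.val h))
    (fun h => h24 (congrArg Subtype.val h)) (fun h => h34 (congrArg Subtype.val h))
  · rintro ⟨e, he⟩ h3
    exact Subtype.ext (hleaf e h3)
  · rintro ⟨e, he⟩ hu
    have hu' : u ∈ ends e := hu
    by_contra hne
    apply he
    rw [hmemS]
    refine ⟨hu', ?_, ?_, ?_, ?_, ?_⟩
    · intro h; exact hne (Or.inl (Subtype.ext h))
    · intro h; exact hne (Or.inr (Or.inl (Subtype.ext h)))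
    · intro h; exact hne (Or.inr (Or.inr (Or.inl (Subtype.ext h))))
    · intro h; exact hne (Or.inr (Or.inr (Or.inr (Or.inl (Subtype.ext h)))))
    · intro h; exact hne (Or.inr (Or.inr (Or.inr (Or.inr (Subtype.ext h)))))

end LeafMulti

section LeafMarks

variable {V : Type*} {E : Type*} [Fintype E] [DecidableEq E] [Fintype V] [DecidableEq V]
  {R : Type*} [Field R] [LinearOrder R] [IsStrictOrderedRing R]

variable (p : E → R) (ends : E → Sym2 V) {f : E} {a₃ u a₁ a₂ o b : V}

/-- **THE TWO-LEVEL THEOREM — (HMF) whenever `a₃` is a pendant at an unmarked `u` every other edge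
of which joins `u` to one of the marks `a₁, a₂, o, b`** (any multiplicities, any subset of the
marks; no representatives, no coincidence hypotheses among the marks). -/
theorem HMF_leaf_marks (hp : IsProbVec p) (hf : ends f = s(a₃, u)) (hleaf : ∀ e, a₃ ∈ ends e → e = f)
    (hstar : ∀ e, u ∈ ends e → ends e = s(u, a₃) ∨ ends e = s(u, a₁) ∨ ends e = s(u, a₂) ∨
      ends e = s(u, o) ∨ ends e = s(u, b))
    (h3u : a₃ ≠ u) (h3o : a₃ ≠ o) (h31 : a₃ ≠ a₁) (h32 : a₃ ≠ a₂) (h3b : a₃ ≠ b) (hu1 : u ≠ a₁)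
    (hu2 : u ≠ a₂) (huo : u ≠ o) (hub : u ≠ b) : HMF p ends o a₁ a₂ a₃ b := by
  rw [← ZeroEdge.HMF_ext_iff p ends s(u, a₁)]
  rw [← ZeroEdge.HMF_ext_iff (ZeroEdge.p' p) (ZeroEdge.ends' ends s(u, a₁)) s(u, a₂)]
  rw [← ZeroEdge.HMF_ext_iff (ZeroEdge.p' (ZeroEdge.p' p))
    (ZeroEdge.ends' (ZeroEdge.ends' ends s(u, a₁)) s(u, a₂)) s(u, o)]
  rw [← ZeroEdge.HMF_ext_iff (ZeroEdge.p' (ZeroEdge.p' (ZeroEdge.p' p)))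
    (ZeroEdge.ends' (ZeroEdge.ends' (ZeroEdge.ends' ends s(u, a₁)) s(u, a₂)) s(u, o)) s(u, b)]
  refine HMF_star_leaf_h_multi _ _
    (ZeroEdge.isProbVec_p' (ZeroEdge.isProbVec_p' (ZeroEdge.isProbVec_p' (ZeroEdge.isProbVec_p' hp))))
    (f := some (some (some (some f)))) (f₁ := some (some (some none))) (f₂ := some (some none))
    (f₃ := some none) (f₄ := none) hf rfl rfl rfl rfl ?_ ?_ h3u h3o h31 h32 h3b hu1 hu2 huo hub
    (by simp) (by simp) (by simp) (by simp) (by simp) (by simp)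
  · -- `a₃` is still a leaf: the adjoined edges avoid `a₃`
    intro e he
    cases e with
    | none =>
      exact absurd he (by simp [ZeroEdge.ends', Sym2.mem_iff, h3u, h3b])
    | some e =>
      cases e with
      | none => exact absurd he (by simp [ZeroEdge.ends', Sym2.mem_iff, h3u, h3o])
      | some e =>
        cases e with
        | none => exact absurd he (by simp [ZeroEdge.ends', Sym2.mem_iff, h3u, h32])
        | some e =>
          cases e with
          | none => exact absurd he (by simp [ZeroEdge.ends', Sym2.mem_iff, h3u, h31])
          | some e => exact congrArg (fun x => some (some (some (some x)))) (hleaf e he)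
  · intro e he
    cases e with
    | none => exact Or.inr (Or.inr (Or.inr (Or.inr rfl)))
    | some e =>
      cases e with
      | none => exact Or.inr (Or.inr (Or.inr (Or.inl rfl)))
      | some e =>
        cases e with
        | none => exact Or.inr (Or.inr (Or.inl rfl))
        | some e =>
          cases e with
          | none => exact Or.inr (Or.inl rfl)
          | some e => exact hstar e he

/-- **THE TWO-LEVEL THEOREM at (HCOV) strength**: (HCOV) whenever `a₃` is a pendant at an unmarked
`u` every other edge of which joins `u` to one of the marks `a₁, a₂, o, b`. -/
theorem HCov_leaf_marks (hp : IsProbVec p) (hf : ends f = s(a₃, u)) (hleaf : ∀ e, a₃ ∈ ends e → e = f)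
    (hstar : ∀ e, u ∈ ends e → ends e = s(u, a₃) ∨ ends e = s(u, a₁) ∨ ends e = s(u, a₂) ∨
      ends e = s(u, o) ∨ ends e = s(u, b))
    (h3u : a₃ ≠ u) (h3o : a₃ ≠ o) (h31 : a₃ ≠ a₁) (h32 : a₃ ≠ a₂) (h3b : a₃ ≠ b) (hu1 : u ≠ a₁)
    (hu2 : u ≠ a₂) (huo : u ≠ o) (hub : u ≠ b) : CovForm.HCov p ends o a₁ a₂ a₃ b :=
  HCov_of_HMF p hp ends o a₁ a₂ a₃ b
    (HMF_leaf_marks p ends hp hf hleaf hstar h3u h3o h31 h32 h3b hu1 hu2 huo hub)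

end LeafMarks

section Whiskers

variable {V : Type*} {E : Type*} [Fintype E] [DecidableEq E] [Fintype V] [DecidableEq V]
  {R : Type*} [Field R] [LinearOrder R] [IsStrictOrderedRing R]

variable (ends : E → Sym2 V) (o a₁ a₂ a₃ b u : V)

/-- **Whiskers are invisible**: the weights of a finset of whiskers can be set to `0` one by one
without changing the (HMF) status (the unmarked leaf is invisible to the mean field). -/
theorem zero_whiskers (S : Finset E)
    (hS : ∀ e ∈ S, (∃ y, ends e = s(u, y) ∧ y ≠ u ∧ y ≠ o ∧ y ≠ a₁ ∧ y ≠ a₂ ∧ y ≠ a₃ ∧ y ≠ b ∧ ∀ e', y ∈ ends e' → e' = e)) :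
    ∀ p : E → R, IsProbVec p → ∃ p' : E → R, IsProbVec p' ∧ (∀ e ∈ S, p' e = 0) ∧
      (∀ e, e ∉ S → p' e = p e) ∧ (HMF p ends o a₁ a₂ a₃ b ↔ HMF p' ends o a₁ a₂ a₃ b) := by
  induction S using Finset.induction_on with
  | empty =>
    intro p hp
    exact ⟨p, hp, fun e he => absurd he (Finset.notMem_empty e), fun _ _ => rfl, Iff.rfl⟩
  | insert e S' he ih =>
    intro p hp
    obtain ⟨y, hey, hyu, hyo, hy1, hy2, hy3, hyb, hyleaf⟩ := hS e (Finset.mem_insert_self e S')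
    have hS'' : ∀ e' ∈ S', (∃ y, ends e' = s(u, y) ∧ y ≠ u ∧ y ≠ o ∧ y ≠ a₁ ∧ y ≠ a₂ ∧ y ≠ a₃ ∧ y ≠ b ∧ ∀ e'', y ∈ ends e'' → e'' = e') := fun e' he' =>
      hS e' (Finset.mem_insert_of_mem he')
    set p₁ := Function.update p e (0 : R) with hp₁
    have hp₁p : IsProbVec p₁ := hp.update e le_rfl zero_le_one
    have hiff : HMF p ends o a₁ a₂ a₃ b ↔ HMF p₁ ends o a₁ a₂ a₃ b := by
      unfold HMF
      have hey' : ends e = s(y, u) := by rw [hey, Sym2.eq_swap]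
      rw [hp₁, HMFLeafInvisible.HMFc_update_leaf (p := p) (ends := ends) (f := e) (x := y) (y := u)
        hey' hyleaf hyu hyo hy1 hy2 hy3 hyb 0]
    obtain ⟨p', hp', hz, hagree, hiff'⟩ := ih hS'' p₁ hp₁p
    refine ⟨p', hp', ?_, ?_, hiff.trans hiff'⟩
    · intro e' he'
      rcases Finset.mem_insert.1 he' with rfl | he'
      · rw [hagree e' he, hp₁, Function.update_self]
      · exact hz e' he'
    · intro e' he'
      have he'' : e' ∉ S' := fun h => he' (Finset.mem_insert_of_mem h)
      have hee : e' ≠ e := fun h => he' (h ▸ Finset.mem_insert_self e S')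
      rw [hagree e' he'', hp₁, Function.update_of_ne hee]


omit [IsStrictOrderedRing R] in
/-- **Deleting an unmarked leaf**: (HMF) is equivalent to (HMF) on the graph without the leaf edge
(the leaf is invisible to the mean field, `HMFLeafInvisible.HMFc_update_leaf`; then `ZeroEdges`). -/
theorem HMF_delete_leaf (p : E → R) {f : E} {x y : V} (hf : ends f = s(x, y))
    (hleaf : ∀ e, x ∈ ends e → e = f) (hxy : x ≠ y) (hxo : x ≠ o) (hx1 : x ≠ a₁) (hx2 : x ≠ a₂)
    (hx3 : x ≠ a₃) (hxb : x ≠ b) :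
    HMF p ends o a₁ a₂ a₃ b ↔
      HMF (ZeroEdges.pR (fun e => e ≠ f) p) (ZeroEdges.endsR (fun e => e ≠ f) ends) o a₁ a₂ a₃ b := by
  have h1 : HMF p ends o a₁ a₂ a₃ b ↔ HMF (Function.update p f (0 : R)) ends o a₁ a₂ a₃ b := by
    unfold HMF
    rw [HMFLeafInvisible.HMFc_update_leaf (p := p) (ends := ends) (f := f) (x := x) (y := y) hf hleaf
      hxy hxo hx1 hx2 hx3 hxb 0]
  have h0 : ∀ e, ¬ (e ≠ f) → Function.update p f (0 : R) e = 0 := by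
    intro e he
    rw [not_not.1 he, Function.update_self]
  have hpR : ZeroEdges.pR (fun e => e ≠ f) (Function.update p f (0 : R)) =
      ZeroEdges.pR (fun e => e ≠ f) p := by
    funext e
    simp only [ZeroEdges.pR, Function.update_of_ne e.2]
  rw [h1, ZeroEdges.HMF_ext_iff (Function.update p f (0 : R)) ends h0, hpR]

variable (p : E → R) {f : E}

/-- **THE TWO-LEVEL THEOREM WITH WHISKERS — (HMF) whenever `a₃` is a pendant at an unmarked `u`
every other edge of which joins `u` to a mark or is a whisker** (an edge to an unmarked leaf). -/
theorem HMF_leaf_marks_whiskers (hp : IsProbVec p) (hf : ends f = s(a₃, u))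
    (hleaf : ∀ e, a₃ ∈ ends e → e = f)
    (hstar : ∀ e, u ∈ ends e → ends e = s(u, a₃) ∨ ends e = s(u, a₁) ∨ ends e = s(u, a₂) ∨
      ends e = s(u, o) ∨ ends e = s(u, b) ∨
      (∃ y, ends e = s(u, y) ∧ y ≠ u ∧ y ≠ o ∧ y ≠ a₁ ∧ y ≠ a₂ ∧ y ≠ a₃ ∧ y ≠ b ∧ ∀ e', y ∈ ends e' → e' = e))
    (h3u : a₃ ≠ u) (h3o : a₃ ≠ o) (h31 : a₃ ≠ a₁) (h32 : a₃ ≠ a₂) (h3b : a₃ ≠ b) (hu1 : u ≠ a₁)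
    (hu2 : u ≠ a₂) (huo : u ≠ o) (hub : u ≠ b) : HMF p ends o a₁ a₂ a₃ b := by
  set S : Finset E := Finset.univ.filter (fun e => (∃ y, ends e = s(u, y) ∧ y ≠ u ∧ y ≠ o ∧ y ≠ a₁ ∧ y ≠ a₂ ∧ y ≠ a₃ ∧ y ≠ b ∧ ∀ e', y ∈ ends e' → e' = e)) with hSdef
  have hmemS : ∀ e, e ∈ S ↔ (∃ y, ends e = s(u, y) ∧ y ≠ u ∧ y ≠ o ∧ y ≠ a₁ ∧ y ≠ a₂ ∧ y ≠ a₃ ∧ y ≠ b ∧ ∀ e', y ∈ ends e' → e' = e) := by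
    intro e; rw [hSdef]; simp
  have hS : ∀ e ∈ S, (∃ y, ends e = s(u, y) ∧ y ≠ u ∧ y ≠ o ∧ y ≠ a₁ ∧ y ≠ a₂ ∧ y ≠ a₃ ∧ y ≠ b ∧ ∀ e', y ∈ ends e' → e' = e) := fun e he => (hmemS e).1 he
  obtain ⟨p', hp', hz, -, hiff⟩ := zero_whiskers ends o a₁ a₂ a₃ b u S hS p hp
  rw [hiff]
  have h0 : ∀ e, ¬ (e ∉ S) → p' e = 0 := fun e h => hz e (not_not.1 h)
  rw [ZeroEdges.HMF_ext_iff p' ends h0]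
  -- the leaf edge is no whisker (its far end is the mark `a₃`)
  have hfS : f ∉ S := by
    intro h
    obtain ⟨y, hey, hyu, -, -, -, hy3, -, -⟩ := (hmemS f).1 h
    rw [hf, Sym2.eq_iff] at hey
    rcases hey with ⟨h1, -⟩ | ⟨h1, -⟩
    · exact h3u h1
    · exact hy3 h1.symm
  refine HMF_leaf_marks (ZeroEdges.pR (fun e => e ∉ S) p') (ZeroEdges.endsR (fun e => e ∉ S) ends)
    (ZeroEdges.isProbVec_pR hp') (f := ⟨f, hfS⟩) hf ?_ ?_ h3u h3o h31 h32 h3b hu1 hu2 huo hub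
  · rintro ⟨e, he⟩ h3
    exact Subtype.ext (hleaf e h3)
  · rintro ⟨e, he⟩ hu
    have hu' : u ∈ ends e := hu
    rcases hstar e hu' with h | h | h | h | h | h
    · exact Or.inl h
    · exact Or.inr (Or.inl h)
    · exact Or.inr (Or.inr (Or.inl h))
    · exact Or.inr (Or.inr (Or.inr (Or.inl h)))
    · exact Or.inr (Or.inr (Or.inr (Or.inr h)))
    · exact absurd ((hmemS e).2 h) he

/-- (HCOV) for the two-level theorem with whiskers. -/
theorem HCov_leaf_marks_whiskers (hp : IsProbVec p) (hf : ends f = s(a₃, u))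
    (hleaf : ∀ e, a₃ ∈ ends e → e = f)
    (hstar : ∀ e, u ∈ ends e → ends e = s(u, a₃) ∨ ends e = s(u, a₁) ∨ ends e = s(u, a₂) ∨
      ends e = s(u, o) ∨ ends e = s(u, b) ∨
      (∃ y, ends e = s(u, y) ∧ y ≠ u ∧ y ≠ o ∧ y ≠ a₁ ∧ y ≠ a₂ ∧ y ≠ a₃ ∧ y ≠ b ∧ ∀ e', y ∈ ends e' → e' = e))
    (h3u : a₃ ≠ u) (h3o : a₃ ≠ o) (h31 : a₃ ≠ a₁) (h32 : a₃ ≠ a₂) (h3b : a₃ ≠ b) (hu1 : u ≠ a₁)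
    (hu2 : u ≠ a₂) (huo : u ≠ o) (hub : u ≠ b) : CovForm.HCov p ends o a₁ a₂ a₃ b :=
  HCov_of_HMF p hp ends o a₁ a₂ a₃ b
    (HMF_leaf_marks_whiskers ends o a₁ a₂ a₃ b u p hp hf hleaf hstar h3u h3o h31 h32 h3b hu1 hu2 huo hub)

end Whiskers

end StarH

end Summit.Ventures.PercRepro2
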